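import Summits.QuantumFields.BalabanUV.Beta.D1BFx.RoadEndBFxRecutMean
import Summits.QuantumFields.BalabanUV.Beta.D1BFx.ShellRoadEndMean

/-!
# Road BF-x, THE MEAN-GRADING END OVER THE RE-CUT REST TABLE AT THE PIN, FAR ROWS h2∕d2 IN SHELL-ℓ¹ CURRENCY (shell twin of the owner's
# `RoadEndBFxRecutMean.d1Drift_BFx_recut_mean_pinned`, p225854)

HONEST DEPENDENCY (page 1, mandatory): continuum YM on T⁴ ⇐ BetaPertH ∧ nine spine estimates (0/9 proved); BetaPertH ⇐ (D1) ∧ (D4) ∧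
CAP+tail; G-an2-4 gates asym, D1 and NE2/3/4.  HONEST FRAMING (cell contract, verbatim): «discharging `BetaPertH` makes Bałaban's UV
stability UNCONDITIONAL — a real constructive-QFT result; it is NOT the continuum limit and NOT the Clay problem.»  THIS MODULE DISCHARGES
NOTHING of the wall: [folklore] re-wiring BY NAME — the owner's mean-grading END with `RoadEndPinned.d1Drift_JsBalAn1Ctr_of_meanRoad_table_pinned`
replaced by this lineage's `ShellRoadEndMean.d1Drift_JsBalAn1Ctr_of_meanRoad_table_pinned_shell` (leaf-07-g4's shell wall underneath); the same
`AssemblyEndRecut.defect_le_at_recut` ∕ `RoadEndBFxRecut.rest_all_of_offCorner` ∕ `RoadEndBFxRecutMean.hT_mean_of_pointwise` wiring.  No `def`, no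
`Prop` mirror, no cited fact, 0 sorry; 0 wall binders (hW∕hR∕D1Tel∕D1Rep = 0∕4); NOT D1, NOT `BetaPertH`, NOT continuum, NOT Clay.

ABSOLUTE RULE (cell charter, verbatim): «No internally-minted statement may enter as a cited fact. Every hypothesis is either kernel-proved in
this package or a verbatim quotation of a PUBLISHED theorem with page reference. The manuscript(s) under audit are NOT citable for their own
disputed steps — they are the thing under adjudication; programme-internal (2001/route/tribunal) claims are never citable.»

WHY: the SUP rows h2∕d2 of `gfrz` are presumably unsatisfiable (edge log: leaf-07-g3 l.10890, beta-num-g33 l.11249, leaf-03-g5 RESULT «EDGE-LOG-ROW»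
kit j101443∕j101444∕j101445; not in [Balaban1984PropagatorsI, Prop. 1.2]'s printed pointwise list) — see `RoadEndBFxRecutShell` for the strong
grading; this is the mean-grading companion.  Unit `b2b-balaban-beta-d1-formalise-leaf-03` (gen 5), D1 formalisation swarm; `LEAVES-BFx.md` sub-row
«C2-SHELL@recut».
-/

noncomputable section

open Finset Filter Topology
open Literature.Probability.LatticeModels (annulus)
open scoped BigOperators
open Literature.MathematicalPhysics.QuantumFieldTheory.Balaban1983to89
open Literature.MathematicalPhysics.QuantumFieldTheory.Balaban1983to89.Beta
open OneStepResolventKernel (JetData)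
open OneStepKernelFamily (TbalOf D1Drift)
open WindowIdentification (fullSum)
open DyadicShell (Pt supNorm)
open ExpKernelCalculus (Site BiLoc shiftK)
open SquareTable (stK)
open GhostTable (gFree)
open BubbleTransfer (unitVec)
open DressedMomentNormalisation (resSite)
open Summit.QuantumFields.BalabanUV.Beta.TameKernelCalculus (Spr)
open Summit.QuantumFields.BalabanUV.Beta.MixedJetTablesPlug (JsBalAn1Ctr)
open Summit.QuantumFields.BalabanUV.Beta.GAN24.StencilSlotOfE3 (one_le_of_two_le)
open Summit.QuantumFields.BalabanUV.Beta.D1BFx.GluonLeg (Ga)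
open Summit.QuantumFields.BalabanUV.Beta.D1BFx.ReducedKernel (TableR TOfRed)
open Summit.QuantumFields.BalabanUV.Beta.D1BFx.DressedTadpoleTable (tableRed)
open Summit.QuantumFields.BalabanUV.Beta.D1BFx.ReducedKernelSandwich (fineHess)
open Summit.QuantumFields.BalabanUV.Beta.D1BFx.FineStencilBFBalaban (SbfBal)
open Summit.QuantumFields.BalabanUV.Beta.D1BFx.SecondStencilBF (Wbf)
open Summit.QuantumFields.BalabanUV.Beta.D1BFx.GhostKernelComplete (PghQ fineHessGhQ)
open Summit.QuantumFields.BalabanUV.Beta.D1BFx.FrozenLegProfile (gfrz gfrz_neg decay_gfrz abs_gfrz_sub_gFree_le abs_gfrz_diff_flat_le)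
open Summit.QuantumFields.BalabanUV.Beta.D1BFx.SplitInstance (RestIdx)
open Summit.QuantumFields.BalabanUV.Beta.D1BFx.SplitRecut (restK')
open Summit.QuantumFields.BalabanUV.Beta.D1BFx.Assembly (sum_uniform_resSite)
open Summit.QuantumFields.BalabanUV.Beta.D1BFx.AssemblyEndRecut (defect_le_at_recut)
open Summit.QuantumFields.BalabanUV.Beta.D1BFx.RoadEndBFxRecut (cornerIdx rowConst gfrz₀ gfrz₀_eq rowConst_nonneg rest_all_of_offCorner)
open Summit.QuantumFields.BalabanUV.Beta.D1BFx.ShellRoadEndMean (d1Drift_JsBalAn1Ctr_of_meanRoad_table_pinned_shell)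
open Summit.QuantumFields.BalabanUV.Beta.D1BFx.RoadEndBFxRecutMean (hT_mean_of_pointwise)
namespace Summit.QuantumFields.BalabanUV.Beta.D1BFx.RoadEndBFxRecutMeanShell

variable {Lc : ℕ} [NeZero Lc] {a N : ℝ} {μ ν : Fin 4} {υ : Type*} [Fintype υ]
  {cE cVH cΛ cR cK cQ cE₂ cJ4 cΛ₂ cR₂ cQ₂ x₀ ωgl ωgh : ℕ → ℝ} {WE WJ WΛ WR WQ : ℕ → TableR} {CE CJ CΛ CRt CQ δW : ℕ → ℝ}
  {Ru : υ → ℕ → ℝ} {CU : υ → ℝ} {CR : RestIdx → ℝ} {A : ℕ → ℝ} {D₂ δ : ℝ}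

/-- [folklore] **ROAD BF-x, MEAN-GRADING END OVER THE RE-CUT TABLE FOR THE LITERAL AT THE PIN, FAR ROWS h2∕d2 IN SHELL-ℓ¹ CURRENCY** (`Odd Lc`,
`2 ≤ Lc`): exactly the owner's `RoadEndBFxRecutMean.d1Drift_BFx_recut_mean_pinned` (p225854) with the rows h2∕d2 of `gfrz` replaced by the shell rows
`h2s`∕`d2s`, composed through `ShellRoadEndMean.d1Drift_JsBalAn1Ctr_of_meanRoad_table_pinned_shell`; every other hypothesis byte-identical. -/
theorem d1Drift_BFx_recut_mean_pinned_shell (hL : 2 ≤ Lc) (hodd : Odd Lc) (cE' cVH' cΛ' cB' : ℝ) (Tc : Fin 4 → Fin 4 → Fin 4 → Fin 4 → ℝ)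
    (hμν : μ ≠ ν) (hN : N ≠ 0) (ha : 0 < a) (c : ℕ → ℝ)
    (hD₂ : 0 ≤ D₂) (hA : ∀ j, 0 ≤ A j) (hδ : 0 < δ)
    -- the frozen profile's far rows: h2s∕d2s in SHELL currency, d0∕d1 pointwise
    (h2s : ∀ n : ℕ, 2 ≤ n → ∀ [NeZero n], ∀ b ∈ (univ : Finset (Fin 4 → Fin n)).image resSite, ∀ r : ℕ, r + 1 ≤ n →
      ∑ v ∈ annulus 4 r (r + 1), |(gfrz n a b (v + unitVec ν + unitVec μ) - gFree (v + unitVec ν + unitVec μ)) -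
          (gfrz n a b (v + unitVec ν) - gFree (v + unitVec ν)) - (gfrz n a b (v + unitVec μ) - gFree (v + unitVec μ)) +
          (gfrz n a b v - gFree v)| ≤ D₂ / (n : ℝ))
    (d0 : ∀ n : ℕ, 2 ≤ n → ∀ [NeZero n], ∀ b ∈ (univ : Finset (Fin 4 → Fin n)).image resSite, ∀ v : Pt, v ≠ 0 →
      |gfrz n a b v| ≤ A 0 * Real.exp (-(δ / n) * supNorm v) / (supNorm v : ℝ) ^ 2)
    (d1 : ∀ n : ℕ, 2 ≤ n → ∀ [NeZero n], ∀ b ∈ (univ : Finset (Fin 4 → Fin n)).image resSite, ∀ v : Pt, v ≠ 0 → ∀ ρ : Fin 4,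
      |gfrz n a b (v + unitVec ρ) - gfrz n a b v| ≤ A 1 * Real.exp (-(δ / n) * supNorm v) / (supNorm v : ℝ) ^ 3)
    (d2s : ∀ n : ℕ, 2 ≤ n → ∀ [NeZero n], ∀ b ∈ (univ : Finset (Fin 4 → Fin n)).image resSite, ∀ r : ℕ, n ≤ r →
      ∑ v ∈ annulus 4 r (r + 1), |gfrz n a b (v + unitVec ν + unitVec μ) - gfrz n a b (v + unitVec ν) - gfrz n a b (v + unitVec μ) + gfrz n a b v| ≤
        A 2 * Real.exp (-(δ / n) * ((r : ℝ) + 1)) / ((r : ℝ) + 1))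
    -- bridge B1 in MEAN form, for the road's own literal at the pin `cE₂ = Lc⁸`
    (hB1 : Tendsto (fun m : ℕ => ((∑ j ∈ range m,
        B12Beta.secondMoment (TbalOf Lc (JsBalAn1Ctr (one_le_of_two_le hL) cE' cVH' cΛ' ((Lc : ℝ) ^ (2 * (3 + 1))) cB' Tc) j) μ ν) - c (Lc ^ m)) / (m : ℝ))
        atTop (𝓝 0))
    -- the (α)-leaf and slot (K) with the loop-weight ratio and the PINNED normalisation
    (hGa : ∀ n : ℕ, 2 ≤ n → ∀ [NeZero n], Spr (Ga n a))
    (hK : ∀ n : ℕ, 2 ≤ n → Odd n → ∀ [NeZero n], c n =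
      ωgl n * B12Beta.secondMoment (TOfRed n a (SbfBal n a (cE n) (cVH n) (cΛ n) (cR n) (cK n) (cQ n))
        (tableRed n (Wbf (cE₂ n) (cJ4 n) (cΛ₂ n) (cR₂ n) (cQ₂ n) (WE n) (WJ n) (WΛ n) (WR n) (WQ n)))) μ ν
      + ωgh n * B12Beta.secondMoment (PghQ n a (x₀ n) (cK n) (cQ n)) μ ν + ∑ u, Ru u n)
    (hω : ∀ n : ℕ, 2 ≤ n → ωgh n * cK n ^ 2 = -2 * (ωgl n * cE n ^ 2)) (hlam : ∀ n : ℕ, 2 ≤ n → ωgl n * cE n ^ 2 = 2 * N ^ 2 * (n : ℝ) ^ 8)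
    -- slot-table sockets
    (hδW : ∀ n, 0 < δW n)
    (hE : ∀ n κ u l u', BiLoc (WE n κ u l u') u u' (CE n) (δW n)) (hJ : ∀ n κ u l u', BiLoc (WJ n κ u l u') u u' (CJ n) (δW n))
    (hΛ : ∀ n κ u l u', BiLoc (WΛ n κ u l u') u u' (CΛ n) (δW n)) (hR : ∀ n κ u l u', BiLoc (WR n κ u l u') u u' (CRt n) (δW n))
    (hQ : ∀ n κ u l u', BiLoc (WQ n κ u l u') u u' (CQ n) (δW n))
    (hEc : ∀ (n : ℕ) (κ : Fin 4) (u : Site 4) (l : Fin 4) (u' t : Site 4),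
      WE n κ (u + (n : ℤ) • t) l (u' + (n : ℤ) • t) = shiftK (-((n : ℤ) • t)) (WE n κ u l u'))
    (hJc : ∀ (n : ℕ) (κ : Fin 4) (u : Site 4) (l : Fin 4) (u' t : Site 4),
      WJ n κ (u + (n : ℤ) • t) l (u' + (n : ℤ) • t) = shiftK (-((n : ℤ) • t)) (WJ n κ u l u'))
    (hΛc : ∀ (n : ℕ) (κ : Fin 4) (u : Site 4) (l : Fin 4) (u' t : Site 4),
      WΛ n κ (u + (n : ℤ) • t) l (u' + (n : ℤ) • t) = shiftK (-((n : ℤ) • t)) (WΛ n κ u l u'))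
    (hRc : ∀ (n : ℕ) (κ : Fin 4) (u : Site 4) (l : Fin 4) (u' t : Site 4),
      WR n κ (u + (n : ℤ) • t) l (u' + (n : ℤ) • t) = shiftK (-((n : ℤ) • t)) (WR n κ u l u'))
    (hQc : ∀ (n : ℕ) (κ : Fin 4) (u : Site 4) (l : Fin 4) (u' t : Site 4),
      WQ n κ (u + (n : ℤ) • t) l (u' + (n : ℤ) • t) = shiftK (-((n : ℤ) • t)) (WQ n κ u l u'))
    (hEs : ∀ n κ u l u', WE n κ u l u' = WE n l u' κ u) (hJs : ∀ n κ u l u', WJ n κ u l u' = WJ n l u' κ u)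
    (hΛs : ∀ n κ u l u', WΛ n κ u l u' = WΛ n l u' κ u) (hRs : ∀ n κ u l u', WR n κ u l u' = WR n l u' κ u)
    (hQs : ∀ n κ u l u', WQ n κ u l u' = WQ n l u' κ u)
    -- first-bond divergence-freeness of the gluon fine Hessian kernel; the ghost Ward rows
    (hdiv : ∀ n : ℕ, 2 ≤ n → ∀ [NeZero n], ∀ (l' : Fin 4) (u' u : Site 4), ∑ κ' : Fin 4,
      (fineHess n a (SbfBal n a (cE n) (cVH n) (cΛ n) (cR n) (cK n) (cQ n))
          (Wbf (cE₂ n) (cJ4 n) (cΛ₂ n) (cR₂ n) (cQ₂ n) (WE n) (WJ n) (WΛ n) (WR n) (WQ n)) κ' l' (u - Pi.single κ' 1) u'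
        - fineHess n a (SbfBal n a (cE n) (cVH n) (cΛ n) (cR n) (cK n) (cQ n))
          (Wbf (cE₂ n) (cJ4 n) (cΛ₂ n) (cR₂ n) (cQ₂ n) (WE n) (WJ n) (WΛ n) (WR n) (WQ n)) κ' l' u u') = 0)
    (hrowgh : ∀ n : ℕ, 2 ≤ n → ∀ [NeZero n], ∀ (κ' l' : Fin 4) (b : Site 4), HasSum (fineHessGhQ n a (x₀ n) (cK n) (cQ n) κ' l' b) 0)
    -- (REST′) for the re-cut words other than the corner, n-UNIFORM; (U)
    (hRest : ∀ n : ℕ, 2 ≤ n → ∀ [NeZero n], ∀ τ : RestIdx, τ ≠ cornerIdx →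
      |∑ b ∈ (univ : Finset (Fin 4 → Fin n)).image resSite, ((n : ℝ) ^ 4)⁻¹ *
        fullSum (fun w : Pt => restK' n a (gfrz n a b) (cE n) (cΛ n) (cR n) (cK n) (cQ n) (cE₂ n) (cJ4 n) (cΛ₂ n) (cR₂ n) (cQ₂ n) (x₀ n)
          (WE n) (WJ n) (WΛ n) (WR n) (WQ n) (ωgl n) (ωgh n) ((n : ℝ) ^ 8) N μ ν b τ w)| ≤ CR τ)
    (hU : ∀ n : ℕ, 2 ≤ n → ∀ u, |Ru u n| ≤ CU u) :
    D1Drift Lc (JsBalAn1Ctr (one_le_of_two_le hL) cE' cVH' cΛ' ((Lc : ℝ) ^ (2 * (3 + 1))) cB' Tc) N μ ν := by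
  refine d1Drift_JsBalAn1Ctr_of_meanRoad_table_pinned_shell hL cE' cVH' cΛ' cB' Tc hμν hN c
    (Bset := fun n => (univ : Finset (Fin 4 → Fin n)).image resSite) (wt := fun n _ => ((n : ℝ) ^ 4)⁻¹) (Gf := gfrz₀ a)
    (D := rowConst a D₂) (A := A) (δ := δ)
    (rowConst_nonneg ha hD₂) hA hδ (fun n _ _ _ => by positivity) (fun n hn => sum_uniform_resSite (by omega)) ?_ ?_ ?_ ?_ ?_ ?_ hB1 ?_
  · intro n hn b _ v
    haveI : NeZero n := ⟨by omega⟩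
    rw [gfrz₀_eq a n]
    exact abs_gfrz_sub_gFree_le n (le_trans one_le_two hn) ha b v
  · intro n hn b _ v ρ
    haveI : NeZero n := ⟨by omega⟩
    rw [gfrz₀_eq a n]
    exact abs_gfrz_diff_flat_le n (le_trans one_le_two hn) ha b v ρ
  · intro n hn b hb r hr
    haveI : NeZero n := ⟨by omega⟩
    rw [gfrz₀_eq a n]
    exact h2s n hn b hb r hr
  · intro n hn b hb v hv
    haveI : NeZero n := ⟨by omega⟩
    rw [gfrz₀_eq a n]
    exact d0 n hn b hb v hv
  · intro n hn b hb v hv ρ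
    haveI : NeZero n := ⟨by omega⟩
    rw [gfrz₀_eq a n]
    exact d1 n hn b hb v hv ρ
  · intro n hn b hb r hr
    haveI : NeZero n := ⟨by omega⟩
    rw [gfrz₀_eq a n]
    exact d2s n hn b hb r hr
  -- the mean target from the pointwise defect bound
  refine hT_mean_of_pointwise (c := c)
    (F := fun n => ∑ b ∈ (univ : Finset (Fin 4 → Fin n)).image resSite, ((n : ℝ) ^ 4)⁻¹ * fullSum (stK μ ν N (gfrz₀ a n b)))
    (U := (∑ u, CU u) + ∑ τ : RestIdx, (if τ = cornerIdx then 0 else CR τ)) (fun n hn hon => ?_) hL hodd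
  haveI : NeZero n := ⟨by omega⟩
  rw [gfrz₀_eq a n]
  exact defect_le_at_recut n a (cE n) (cVH n) (cΛ n) (cR n) (cK n) (cQ n) (cE₂ n) (cJ4 n) (cΛ₂ n) (cR₂ n) (cQ₂ n) (x₀ n) (ωgl n) (ωgh n)
    ((n : ℝ) ^ 8) N (gp := gfrz n a) hn hon ha hμν (hGa n hn) (hK n hn hon) (hω n hn) (hlam n hn) (hδW n) (hE n) (hJ n) (hΛ n) (hR n)
    (hQ n) (hEc n) (hJc n) (hΛc n) (hRc n) (hQc n) (hEs n) (hJs n) (hΛs n) (hRs n) (hQs n) (hdiv n hn) (hrowgh n hn)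
    (fun b => decay_gfrz (hGa n hn) b) (fun b w => gfrz_neg w)
    (rest_all_of_offCorner n a (cE n) (cΛ n) (cR n) (cK n) (cQ n) (cE₂ n) (cJ4 n) (cΛ₂ n) (cR₂ n) (cQ₂ n) (x₀ n) (ωgl n) (ωgh n) N
      (WE n) (WJ n) (WΛ n) (WR n) (WQ n) hμν (hGa n hn) (hRest n hn)) (hU n hn)

end Summit.QuantumFields.BalabanUV.Beta.D1BFx.RoadEndBFxRecutMeanShell

end
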